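import Literature.MathematicalPhysics.KineticTheory.HardSphereEulerProofs
import Mathlib.Analysis.Calculus.MeanValue
import HarnessLib

/-!
# Assembly of route `OneSphereInfluence` (stmt-AtomisticToContinuum-14700): convergence lemmas

Helper file for the assembly item `…Theses.OneSphereInfluence.Assembly`. Four pieces of folklore
used to glue the cruxes of the route to the conjunct:

* `tendsto_integral_of_tendsto_measure_of_sq_le` — convergence in probability plus a uniform
  second-moment bound gives convergence of the means (uniform integrability; used at the
  `κ = 0` end of the homotopy, where the law of large numbers at time `0` is only in probability);
* `integral_comp_flow_eq_of_lawAt_eq` — under a flow-invariant law the mean of an observable is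
  conserved in time (used with the proved support `HomogeneousInvariance`);
* `abs_sub_sub_le_of_abs_deriv_sub_le` — the mean value inequality on `[0,1]` for two functions
  continuous on `[0,1]` whose (interior, resp. one-sided) derivatives are uniformly `ε`-close:
  `|(f 1 - f 0) - (g 1 - g 0)| ≤ ε` (interior segments `[α, β] ⊂ (0,1)` and a limit to the
  endpoints; used with `f = E_{p_κ} F_t`, `g = ⟨U_κ(t), χ⟩` and the uniform score response);
* `tendsto_measure_lt_abs_sub_of_variance` — Chebyshev: vanishing variances and converging means
  give convergence in probability.

No definitions, no named facts.
-/

noncomputable section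

open MeasureTheory ProbabilityTheory Filter Set Topology Real
open scoped ENNReal

namespace Summit.AtomisticToContinuum.HydrodynamicLimit.Theorems.OneSphereInfluenceAssembly

/-! ## Convergence in probability and `L²` bounds give convergence of means -/

/-- Pointwise three-way split: `|Y ω| ≤ δ + (Y ω)²/L + L 𝟙{δ < |Y|}(ω)` for `δ ≥ 0`, `L > 0`.
[folklore] -/
theorem abs_le_three_way_split {α : Type*} (Y : α → ℝ) {δ L : ℝ} (hδ0 : 0 ≤ δ) (hL : 0 < L) (ω : α) :
    |Y ω| ≤ δ + Y ω ^ 2 / L + L * Set.indicator {ω' | δ < |Y ω'|} (fun _ => (1 : ℝ)) ω := by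
  by_cases hδ : |Y ω| ≤ δ
  · have h1 : 0 ≤ Y ω ^ 2 / L := by positivity
    have h2 : 0 ≤ L * Set.indicator {ω' | δ < |Y ω'|} (fun _ => (1 : ℝ)) ω :=
      mul_nonneg hL.le (Set.indicator_nonneg (fun _ _ => zero_le_one) _)
    linarith
  · push Not at hδ
    rw [Set.indicator_of_mem (show ω ∈ {ω' | δ < |Y ω'|} from hδ), mul_one]
    by_cases hyL : |Y ω| ≤ L
    · have h1 : 0 ≤ Y ω ^ 2 / L := by positivity
      linarith [hδ.le]
    · push Not at hyL
      have h3 : |Y ω| ≤ Y ω ^ 2 / L := by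
        rw [le_div_iff₀ hL, ← sq_abs]
        nlinarith [abs_nonneg (Y ω)]
      linarith [hδ.le, abs_nonneg (Y ω)]

/-- **Convergence in probability with uniformly bounded second moments implies convergence of the
means.** On probability spaces `(Ω_N, P_N)`, if `X_N ∈ L²(P_N)` is measurable with `E X_N² ≤ M`
and `P_N(δ < |X_N - c|) → 0` for every `δ > 0`, then `E X_N → c`. [folklore] -/
theorem tendsto_integral_of_tendsto_measure_of_sq_le {Ω : ℕ → Type*} [∀ N, MeasurableSpace (Ω N)]
    {P : (N : ℕ) → Measure (Ω N)} [∀ N, IsProbabilityMeasure (P N)] {X : (N : ℕ) → Ω N → ℝ}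
    (hXm : ∀ N, Measurable (X N)) {c M : ℝ} (hX : ∀ N, MemLp (X N) 2 (P N))
    (hM : ∀ N, ∫ ω, X N ω ^ 2 ∂P N ≤ M)
    (hprob : ∀ δ > (0 : ℝ), Tendsto (fun N => P N {ω | δ < |X N ω - c|}) atTop (𝓝 0)) :
    Tendsto (fun N => ∫ ω, X N ω ∂P N) atTop (𝓝 c) := by
  rw [Metric.tendsto_atTop]
  intro ε hε
  set M' : ℝ := 2 * M + 2 * c ^ 2 with hM'
  have hM0 : 0 ≤ M := le_trans (integral_nonneg fun ω => sq_nonneg _) (hM 0)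
  have hM'0 : 0 ≤ M' := by positivity
  set L : ℝ := 3 * M' / ε + 1 with hL
  have hLpos : 0 < L := by positivity
  have hML : M' / L ≤ ε / 3 := by
    rw [div_le_iff₀ hLpos, hL]
    nlinarith [div_mul_cancel₀ (3 * M') hε.ne']
  have hsmall : ∀ᶠ N in atTop, (P N {ω | ε / 3 < |X N ω - c|}).toReal < ε / (3 * L) := by
    have h := (ENNReal.tendsto_toReal ENNReal.zero_ne_top).comp (hprob (ε / 3) (by positivity))
    rw [ENNReal.toReal_zero] at h
    exact h.eventually (gt_mem_nhds (by positivity))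
  obtain ⟨N₀, hN₀⟩ := eventually_atTop.1 hsmall
  refine ⟨N₀, fun N hN => ?_⟩
  have hPN := hN₀ N hN
  set Y : Ω N → ℝ := fun ω => X N ω - c with hY
  have hY2 : MemLp Y 2 (P N) := (hX N).sub (memLp_const c)
  have hYint : Integrable Y (P N) := hY2.integrable one_le_two
  have hY2int : Integrable (fun ω => Y ω ^ 2) (P N) := hY2.integrable_sq
  set A : Set (Ω N) := {ω | ε / 3 < |Y ω|} with hA
  have hAm : MeasurableSet A :=
    measurableSet_lt measurable_const (continuous_abs.measurable.comp ((hXm N).sub measurable_const))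
  have hind : Integrable (fun ω => L * A.indicator (fun _ => (1 : ℝ)) ω) (P N) :=
    ((integrable_const (1 : ℝ)).indicator hAm).const_mul L
  -- second moment of `Y`
  have hY2le : ∫ ω, Y ω ^ 2 ∂P N ≤ M' := by
    have hpt : ∀ ω, Y ω ^ 2 ≤ 2 * X N ω ^ 2 + 2 * c ^ 2 := fun ω => by
      rw [hY]
      nlinarith [sq_nonneg (X N ω + c)]
    calc ∫ ω, Y ω ^ 2 ∂P N ≤ ∫ ω, (2 * X N ω ^ 2 + 2 * c ^ 2) ∂P N :=
          integral_mono hY2int (((hX N).integrable_sq.const_mul 2).add (integrable_const _)) hpt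
      _ = 2 * ∫ ω, X N ω ^ 2 ∂P N + 2 * c ^ 2 := by
          rw [integral_add ((hX N).integrable_sq.const_mul 2) (integrable_const _), integral_const_mul,
            integral_const, smul_eq_mul, probReal_univ, one_mul]
      _ ≤ M' := by rw [hM']; linarith [hM N]
  -- the three-way split, integrated
  have hsplit : ∫ ω, |Y ω| ∂P N ≤ ε / 3 + M' / L + L * (P N A).toReal := by
    calc ∫ ω, |Y ω| ∂P N
        ≤ ∫ ω, (ε / 3 + Y ω ^ 2 / L + L * A.indicator (fun _ => (1 : ℝ)) ω) ∂P N :=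
          integral_mono hYint.abs (((integrable_const _).add (hY2int.div_const L)).add hind)
            fun ω => abs_le_three_way_split Y (by positivity) hLpos ω
      _ = ε / 3 + (∫ ω, Y ω ^ 2 ∂P N) / L + L * (P N A).toReal := by
          have h12 : Integrable (fun ω => ε / 3 + Y ω ^ 2 / L) (P N) := by
            exact (integrable_const _).add (hY2int.div_const L)
          rw [integral_add h12 hind, integral_add (integrable_const _) (hY2int.div_const L),
            integral_const, smul_eq_mul, probReal_univ, one_mul, integral_const_mul,
            integral_indicator_const (1 : ℝ) hAm, integral_div, smul_eq_mul, mul_one, measureReal_def]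
      _ ≤ ε / 3 + M' / L + L * (P N A).toReal := by
          have := div_le_div_of_nonneg_right hY2le hLpos.le
          linarith
  have hLA : L * (P N A).toReal < ε / 3 := by
    calc L * (P N A).toReal < L * (ε / (3 * L)) := mul_lt_mul_of_pos_left hPN hLpos
      _ = ε / 3 := by field_simp
  rw [Real.dist_eq]
  calc |∫ ω, X N ω ∂P N - c| = |∫ ω, Y ω ∂P N| := by
        rw [hY, integral_sub ((hX N).integrable one_le_two) (integrable_const c), integral_const,
          smul_eq_mul, probReal_univ, one_mul]
    _ ≤ ∫ ω, |Y ω| ∂P N := abs_integral_le_integral_abs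
    _ < ε := by linarith

/-! ## Invariant laws conserve means -/

/-- **Under a flow-invariant law, means are conserved**: if `(Φ_t)_* P = P` then
`∫ G (Φ_t z) dP = ∫ G dP` for every measurable real `G`. [folklore] -/
theorem integral_comp_flow_eq_of_lawAt_eq {d : Type*} [Fintype d] {X : Type*} [MeasureSpace X]
    [TopologicalSpace X] {G₀ : Literature.Analysis.FluidPDE.Geometry d X} {ε : ℝ} {n : ℕ}
    (Φ : Literature.Analysis.FluidPDE.HardSphereFlow G₀ ε n)
    {P : Measure (Literature.Analysis.FluidPDE.Config n d X)} {t : ℝ} (hinv : Φ.lawAt P t = P)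
    {G : Literature.Analysis.FluidPDE.Config n d X → ℝ} (hG : Measurable G) :
    ∫ z, G (Φ.flow t z) ∂P = ∫ z, G z ∂P := by
  have h := integral_map (μ := P) (Φ.measurable_flow t).aemeasurable (f := G) hG.aestronglyMeasurable
  rw [← Literature.Analysis.FluidPDE.HardSphereFlow.lawAt_eq, hinv] at h
  exact h.symm

/-! ## Mean value inequality with uniformly close derivatives, up to the endpoints -/

/-- **Mean value inequality on `[0,1]` with `ε`-close derivatives.** If `f, g : ℝ → ℝ` are
continuous on `[0,1]`, `f` has derivative `f'` at every interior point, `g` has one-sided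
derivative `g'` within `[0,1]` at every interior point, and `|f' κ - g' κ| ≤ ε` on `(0,1)`, then
`|(f 1 - f 0) - (g 1 - g 0)| ≤ ε`. [folklore] -/
theorem abs_sub_sub_le_of_abs_deriv_sub_le {f g f' g' : ℝ → ℝ} {ε : ℝ}
    (hf : ContinuousOn f (Icc 0 1)) (hg : ContinuousOn g (Icc 0 1))
    (hfd : ∀ κ ∈ Ioo (0 : ℝ) 1, HasDerivAt f (f' κ) κ)
    (hgd : ∀ κ ∈ Ioo (0 : ℝ) 1, HasDerivWithinAt g (g' κ) (Icc 0 1) κ)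
    (hε : ∀ κ ∈ Ioo (0 : ℝ) 1, |f' κ - g' κ| ≤ ε) :
    |(f 1 - f 0) - (g 1 - g 0)| ≤ ε := by
  set h : ℝ → ℝ := fun κ => f κ - g κ with hh
  have hhc : ContinuousOn h (Icc 0 1) := hf.sub hg
  -- interior segments
  have hseg : ∀ α β : ℝ, 0 < α → α ≤ β → β < 1 → |h β - h α| ≤ ε := by
    intro α β hα hαβ hβ
    have hε0 : 0 ≤ ε := by
      have hm : (α + β) / 2 ∈ Ioo (0 : ℝ) 1 := ⟨by linarith, by linarith⟩
      exact (abs_nonneg _).trans (hε _ hm)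
    have hder : ∀ x ∈ Icc α β, HasDerivWithinAt h (f' x - g' x) (Icc α β) x := by
      intro x hx
      have hxI : x ∈ Ioo (0 : ℝ) 1 := ⟨hα.trans_le hx.1, hx.2.trans_lt hβ⟩
      exact ((hfd x hxI).hasDerivWithinAt).sub
        ((hgd x hxI).mono (Icc_subset_Icc hα.le hβ.le))
    have hbound : ∀ x ∈ Ico α β, ‖f' x - g' x‖ ≤ ε := fun x hx =>
      by rw [Real.norm_eq_abs]; exact hε x ⟨hα.trans_le hx.1, hx.2.trans hβ⟩
    have hmv := norm_image_sub_le_of_norm_deriv_le_segment' hder hbound β (right_mem_Icc.2 hαβ)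
    rw [Real.norm_eq_abs] at hmv
    calc |h β - h α| ≤ ε * (β - α) := hmv
      _ ≤ ε * 1 := mul_le_mul_of_nonneg_left (by linarith) hε0
      _ = ε := mul_one ε
  -- limit `α → 0⁺` for fixed `β`
  have hβ0 : ∀ β : ℝ, 0 < β → β < 1 → |h β - h 0| ≤ ε := by
    intro β hβ hβ1
    have hlim : Tendsto (fun α => |h β - h α|) (𝓝[Ioo 0 β] 0) (𝓝 |h β - h 0|) := by
      have h0 : ContinuousWithinAt h (Icc 0 1) 0 := hhc 0 ⟨le_rfl, zero_le_one⟩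
      have h1 : Tendsto h (𝓝[Ioo 0 β] 0) (𝓝 (h 0)) :=
        h0.tendsto.mono_left (nhdsWithin_mono _ fun x hx => ⟨hx.1.le, hx.2.le.trans hβ1.le⟩)
      exact (tendsto_const_nhds.sub h1).abs
    haveI : (𝓝[Ioo (0 : ℝ) β] 0).NeBot := by
      rw [nhdsWithin_Ioo_eq_nhdsGT hβ]
      infer_instance
    refine le_of_tendsto hlim ?_
    filter_upwards [self_mem_nhdsWithin] with α hα
    exact hseg α β hα.1 hα.2.le hβ1
  -- limit `β → 1⁻`
  have hlim : Tendsto (fun β => |h β - h 0|) (𝓝[Ioo 0 1] 1) (𝓝 |h 1 - h 0|) := by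
    have h0 : ContinuousWithinAt h (Icc 0 1) 1 := hhc 1 ⟨zero_le_one, le_rfl⟩
    have h1 : Tendsto h (𝓝[Ioo 0 1] 1) (𝓝 (h 1)) :=
      h0.tendsto.mono_left (nhdsWithin_mono _ Ioo_subset_Icc_self)
    exact (h1.sub tendsto_const_nhds).abs
  haveI : (𝓝[Ioo (0 : ℝ) 1] 1).NeBot := by
    rw [nhdsWithin_Ioo_eq_nhdsLT zero_lt_one]
    infer_instance
  have hres : |h 1 - h 0| ≤ ε := by
    refine le_of_tendsto hlim ?_
    filter_upwards [self_mem_nhdsWithin] with β hβ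
    exact hβ0 β hβ.1 hβ.2
  simpa [hh, sub_sub_sub_comm] using hres

/-! ## Chebyshev: vanishing variance and converging means give convergence in probability -/

/-- **Chebyshev.** On finite measure spaces `(Ω_N, P_N)`, if `X_N ∈ L²(P_N)`, `Var(X_N) → 0` and
`E X_N → c`, then `P_N(δ < |X_N - c|) → 0` for every `δ > 0`. [folklore] -/
theorem tendsto_measure_lt_abs_sub_of_variance {Ω : ℕ → Type*} [∀ N, MeasurableSpace (Ω N)]
    {P : (N : ℕ) → Measure (Ω N)} [∀ N, IsFiniteMeasure (P N)] {X : (N : ℕ) → Ω N → ℝ} {c : ℝ}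
    (hX : ∀ N, MemLp (X N) 2 (P N))
    (hvar : Tendsto (fun N => variance (X N) (P N)) atTop (𝓝 0))
    (hmean : Tendsto (fun N => ∫ ω, X N ω ∂P N) atTop (𝓝 c)) {δ : ℝ} (hδ : 0 < δ) :
    Tendsto (fun N => P N {ω | δ < |X N ω - c|}) atTop (𝓝 0) := by
  have hδ2 : 0 < δ / 2 := half_pos hδ
  -- Chebyshev bound tends to zero
  have hcheb : Tendsto (fun N => ENNReal.ofReal (variance (X N) (P N) / (δ / 2) ^ 2)) atTop (𝓝 0) := by
    have h := ENNReal.tendsto_ofReal (hvar.div_const ((δ / 2) ^ 2))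
    rwa [zero_div, ENNReal.ofReal_zero] at h
  -- eventually the mean is `δ/2`-close to `c`
  have hclose : ∀ᶠ N in atTop, |∫ ω, X N ω ∂P N - c| < δ / 2 := by
    have h := Metric.tendsto_atTop.1 hmean (δ / 2) hδ2
    obtain ⟨N₀, hN₀⟩ := h
    exact eventually_atTop.2 ⟨N₀, fun N hN => by simpa [Real.dist_eq] using hN₀ N hN⟩
  refine tendsto_of_tendsto_of_tendsto_of_le_of_le' tendsto_const_nhds hcheb
    (Eventually.of_forall fun N => zero_le) ?_
  filter_upwards [hclose] with N hN
  refine le_trans (measure_mono fun ω hω => ?_) (meas_ge_le_variance_div_sq (hX N) hδ2)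
  simp only [Set.mem_setOf_eq] at hω ⊢
  have htri : |X N ω - c| ≤ |X N ω - ∫ x, X N x ∂P N| + |∫ x, X N x ∂P N - c| := by
    have := abs_sub_le (X N ω) (∫ x, X N x ∂P N) c
    exact this
  linarith

end Summit.AtomisticToContinuum.HydrodynamicLimit.Theorems.OneSphereInfluenceAssembly

end
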